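import Summits.Parity.GeneralizedHardyLittlewood.Theorems.FordMaynardSieveConst01651SieveConst01651Dim5Check
import Summits.Parity.GeneralizedHardyLittlewood.Theorems.FordMaynardSieveConst01651SieveConst01651Witness
import HarnessLib

/-!
# Route `FordMaynardSieveConst01651`, target `SieveConst01651` (stmt-Parity-19185), stub `stub_coneCertClosed`,
# residue `h5`: the packed table agrees with the tree table (rows 0–11)

Def-free helper file.  `g2Fast` (21-bit digits of the 36 packed naturals `g2Rows` of `…Dim5Data`) coincides with
`g2Lookup` (`List.find?` in `certG2`) — row by row by kernel evaluation (`decide`, 168 tree lookups per row, ≈ 12 s of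
kernel time each), and identically `0` outside `a ≤ 35, b ≤ 83, j ≤ 1` by the table fact `certG2_fst_le`.  This links the
dimension-5 type checker to the witness `coneCert` (assembled as `g2Fast_eq_g2Lookup` in `…Dim5Final`).

References: [FordMaynard2024PrimeSieves] arXiv:2407.14368, §8.2.
-/

namespace Summit.Parity.GeneralizedHardyLittlewood.FordMaynardSieveConst01651SieveConst01651

/-- Row `0` of the packed table agrees with `certG2` (kernel evaluation). [folklore] -/
theorem g2Fast_row_0 : ∀ b, b ≤ 83 → ∀ j, j ≤ 1 → g2Fast 0 b j = g2Lookup 0 b j := by decide +kernel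

/-- Row `1` of the packed table agrees with `certG2` (kernel evaluation). [folklore] -/
theorem g2Fast_row_1 : ∀ b, b ≤ 83 → ∀ j, j ≤ 1 → g2Fast 1 b j = g2Lookup 1 b j := by decide +kernel

/-- Row `2` of the packed table agrees with `certG2` (kernel evaluation). [folklore] -/
theorem g2Fast_row_2 : ∀ b, b ≤ 83 → ∀ j, j ≤ 1 → g2Fast 2 b j = g2Lookup 2 b j := by decide +kernel

/-- Row `3` of the packed table agrees with `certG2` (kernel evaluation). [folklore] -/
theorem g2Fast_row_3 : ∀ b, b ≤ 83 → ∀ j, j ≤ 1 → g2Fast 3 b j = g2Lookup 3 b j := by decide +kernel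

/-- Row `4` of the packed table agrees with `certG2` (kernel evaluation). [folklore] -/
theorem g2Fast_row_4 : ∀ b, b ≤ 83 → ∀ j, j ≤ 1 → g2Fast 4 b j = g2Lookup 4 b j := by decide +kernel

/-- Row `5` of the packed table agrees with `certG2` (kernel evaluation). [folklore] -/
theorem g2Fast_row_5 : ∀ b, b ≤ 83 → ∀ j, j ≤ 1 → g2Fast 5 b j = g2Lookup 5 b j := by decide +kernel

/-- Row `6` of the packed table agrees with `certG2` (kernel evaluation). [folklore] -/
theorem g2Fast_row_6 : ∀ b, b ≤ 83 → ∀ j, j ≤ 1 → g2Fast 6 b j = g2Lookup 6 b j := by decide +kernel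

/-- Row `7` of the packed table agrees with `certG2` (kernel evaluation). [folklore] -/
theorem g2Fast_row_7 : ∀ b, b ≤ 83 → ∀ j, j ≤ 1 → g2Fast 7 b j = g2Lookup 7 b j := by decide +kernel

/-- Row `8` of the packed table agrees with `certG2` (kernel evaluation). [folklore] -/
theorem g2Fast_row_8 : ∀ b, b ≤ 83 → ∀ j, j ≤ 1 → g2Fast 8 b j = g2Lookup 8 b j := by decide +kernel

/-- Row `9` of the packed table agrees with `certG2` (kernel evaluation). [folklore] -/
theorem g2Fast_row_9 : ∀ b, b ≤ 83 → ∀ j, j ≤ 1 → g2Fast 9 b j = g2Lookup 9 b j := by decide +kernel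

/-- Row `10` of the packed table agrees with `certG2` (kernel evaluation). [folklore] -/
theorem g2Fast_row_10 : ∀ b, b ≤ 83 → ∀ j, j ≤ 1 → g2Fast 10 b j = g2Lookup 10 b j := by decide +kernel

/-- Row `11` of the packed table agrees with `certG2` (kernel evaluation). [folklore] -/
theorem g2Fast_row_11 : ∀ b, b ≤ 83 → ∀ j, j ≤ 1 → g2Fast 11 b j = g2Lookup 11 b j := by decide +kernel

end Summit.Parity.GeneralizedHardyLittlewood.FordMaynardSieveConst01651SieveConst01651
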